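import Summits.QuantumFields.BalabanUV.T4Continuum.Support.NE7StraightDefectLetters
import HarnessLib

/-!
# NE7HessFlatCutoffLeibniz — THE CUTOFF LEIBNIZ RULE FOR THE FLAT HESSIAN: moving a scalar weight `g` from the representative to the test direction,
# `hess_1(g•X, Y) − hess_1(X, g•Y)`, costs only COMMUTATOR terms supported where `g` varies, of density `2·#Plane·(2c₁α₁ + c₂α₀)` —
# `c₁`, `c₂` = sup of the FIRST and SECOND lattice differences of `g`, `α₀`, `α₁` = sup and lattice differences of `X` (by parts once: the second differences
# of `g` replace one lattice difference of `X`)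

Cell `pub-balaban`, rung (B)+1 sub-cell t4, lineage `b2b-balaban-t4-ne7-p1` (CRUX PROVER NE7 #1 = OWNER of row NE7), generation 90; memo
`t4/b2b-balaban-t4-ne7-p1-g90/DEFECT-FAR.md` §1–§2.  File F273 (over F38 `NE7ApeFlatSkeleton.hess_flat`, `NE3SmoothLiftCurl.curlAt_flat_eq`, the by-parts pattern of
`NE7ExpansionSegmentLetters.abs_sum_nReTr_curlAt_flat_mul_le`, `sum_periodBox_shift`).

WHY (memo §1).  The v4 END F263 `NE7ApeOfTorusRoadV4.hape_of_torusRoadV4` asks per plaquette for the two-region defect `|dAction_{e^A} Y| ≤ τn‖Y‖_{near} + τf‖Y‖_{far}` on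
straight tangents with the line `K·M·(… + e^{−cℓ}(τf + ρ)) + … ≤ (c₀ + θr)∕M²`; its first supplier F268 pays the far piece by the sup density `ρ + 4#Plane·α₁` (F267 (a)),
and `4#Plane·α₁ ≍ r∕M²` is ONE POWER OF `M` SHORT (`K·M·e^{−cℓ}·r∕M² = K e^{−cℓ} r∕M` against `θr∕M²`; `ℓ < N∕2` is bounded at fixed `N`).  The repair moves the
CUTOFF of the representative `A = χ•Ã` onto the test direction: `hess_1(χ•Ã, Y) = hess_1(Ã, χ•Y) + commutators`, and `hess_1(Ã, χ•Y)` is paid through the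
criticality of `U′ = e^{Ã}` near the support of `χ` (F268's inner piece; F51's budget needs only `sup‖Ã‖`).  THIS FILE is the commutator estimate: after ONE
summation by parts the commutators carry a lattice difference of `Ã` times a first difference of `χ` or `Ã` itself times a SECOND difference of `χ` — densities
`α₁∕ρ`, `α₀∕ρ²`, both `O(M⁻³)` for a cutoff of length scale `ρ ≍ RM` sites.
WHAT ([folklore] lattice bookkeeping at the flat background; 0 def, 0 sorry; generic `d`).
§1 **`curlAt_flat_weight`** — `d_1(g•X)(z;μ,ν) = g(z)•d_1X(z;μ,ν) + [(g(z+e_μ) − g(z))•X(z+e_μ,ν) − (g(z+e_ν) − g(z))•X(z+e_ν,μ)]`.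
§2 **`hess_flat_weight_sub`** — `hess_1(g•X,Y)(W) − hess_1(X,g•Y)(W) = Σ_{p∈W} (Re tr[E^Y_p·d_1X(p)] − Re tr[d_1Y(p)·E^X_p])∕N` (the weighted terms cancel plaquettewise).
§3 **`abs_sum_nReTr_curlAt_flat_mul_le_local`** — the by-parts letter of `NE7ExpansionSegmentLetters` LOCALISED: adjacent differences of `G` bounded by `γ` on a set
   `V` and `0` off it give `|Σ_{p∈perWin} Re tr[d_1Y(p) G(p)]∕N| ≤ γ·#Plane·‖Y‖_{ℓ¹(periodBox ∩ V)}`.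
§4 **`abs_hess_flat_weight_sub_le`** — for `P`-periodic `g, X, Y` with `|δg| ≤ c₁`, `|δ²g| ≤ c₂` (pure and mixed), `‖X‖ ≤ α₀`, `‖δX‖ ≤ α₁`, a periodic set `V′`
   containing every site `z` at which `g` varies along a bond together with its neighbours `z + e_κ`:
   `|hess_1(g•X,Y)(perWin P) − hess_1(X,g•Y)(perWin P)| ≤ 2·#Plane·(2c₁α₁ + c₂α₀)·‖Y‖_{ℓ¹(periodBox P ∩ V′)}`.
HONEST FRAMING (page 1): bookkeeping identities and a triangle inequality; nothing of Bałaban's asserted; NOT (APE), NOT ONE-STEP, NOT NE7; spine 0∕9; finite T⁴ rung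
(B)+1 — NOT infinite volume, NOT mass gap, NOT `BetaPertH`, NOT Clay.  Continuum YM on T⁴ ⇐ BetaPertH ∧ nine spine estimates (0/9 proved); BetaPertH ⇐ (D1) ∧ (D4) ∧
CAP+tail; G-an2-4 gates asym, D1 and NE2/3/4.
-/

set_option autoImplicit false

open scoped BigOperators Matrix.Norms.L2Operator
open NormedSpace Finset Set

namespace Summit.QuantumFields.BalabanUV.T4Continuum.NE7HessFlatCutoffLeibniz

open Literature.MathematicalPhysics.QuantumFieldTheory.Balaban1983to89
open B7Prop1Explicit B7Prop2Explicit MatrixLog UnitaryModel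
open T4AveragingDeficitWall (curl curlAt dirL1)
open T4AveragingDeficitWallBoundary (periodBox sum_periodBox_shift)
open AveragingDeficitPeriodicCounting (IsPeriodicDir)
open AveragingDeficitNearIdentity (abs_nReTr_mul_le)
open AveragingDeficitDualResidual (pair_le_sum)
open MinimalActionLevels (perWin)
open NE3HessForm (hess)
open BlockAveragePushDirSplit (flat)
open NE3SmoothLiftCurl (curlAt_flat_eq)
open NE7ExpansionSegmentLetters (smallField_flat_zero norm_curlAt_flat_le)
open NE7ApeFlatSkeleton (hess_flat)

noncomputable section

variable {d : ℕ} {n : Type*} [Fintype n] [DecidableEq n]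

/-! ## §1 The Leibniz rule for the flat curl -/

/-- **`d_1(g•X) = g•d_1X + E^X`**: the flat curl of a weighted direction is the weight at the base corner times the flat curl, plus the commutator
`E^X(z;μ,ν) = (g(z+e_μ) − g(z))•X(z+e_μ,ν) − (g(z+e_ν) − g(z))•X(z+e_ν,μ)`. [folklore] -/
theorem curlAt_flat_weight (g : Site d → ℝ) (X : Site d → Fin d → Matrix n n ℂ) (z : Site d) (μ ν : Fin d) :
    curlAt (flat (d := d) (n := n)) (fun y κ => g y • X y κ) z μ ν
      = g z • curlAt (flat (d := d) (n := n)) X z μ ν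
        + ((g (z + e μ) - g z) • X (z + e μ) ν - (g (z + e ν) - g z) • X (z + e ν) μ) := by
  rw [curlAt_flat_eq, curlAt_flat_eq]
  simp only [sub_smul, smul_sub]
  abel

/-! ## §2 The weighted terms cancel plaquettewise -/

/-- **`hess_1(g•X,Y)(W) − hess_1(X,g•Y)(W) = Σ_{p∈W} (Re tr[E^Y_p·d_1X(p)] − Re tr[d_1Y(p)·E^X_p])∕N`** for every window `W`: by F38 `hess_flat` both Hessians are
`−Σ_p Re tr[d_1(·)(p)·d_1(·)(p)]∕N`, and after §1 the terms `g(z)·Re tr[d_1Y·d_1X]` cancel. [folklore] -/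
theorem hess_flat_weight_sub (g : Site d → ℝ) (X Y : Site d → Fin d → Matrix n n ℂ) (W : Finset (T4AveragingDeficitWall.Plaq d)) :
    hess (flat (d := d) (n := n)) (fun y κ => g y • X y κ) Y W - hess (flat (d := d) (n := n)) X (fun y κ => g y • Y y κ) W
      = ∑ p ∈ W, (nReTr (((g (p.1 + e p.2.1.1) - g p.1) • Y (p.1 + e p.2.1.1) p.2.1.2 - (g (p.1 + e p.2.1.2) - g p.1) • Y (p.1 + e p.2.1.2) p.2.1.1)
              * curlAt (flat (d := d) (n := n)) X p.1 p.2.1.1 p.2.1.2)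
          - nReTr (curlAt (flat (d := d) (n := n)) Y p.1 p.2.1.1 p.2.1.2
              * ((g (p.1 + e p.2.1.1) - g p.1) • X (p.1 + e p.2.1.1) p.2.1.2 - (g (p.1 + e p.2.1.2) - g p.1) • X (p.1 + e p.2.1.2) p.2.1.1))) := by
  have hsm : ∀ (c : ℝ) (M : Matrix n n ℂ), nReTr (c • M) = c * nReTr M := fun c M => by
    rw [← T4AveragingDeficitWall.nReTrL_apply (c • M), map_smul, T4AveragingDeficitWall.nReTrL_apply, smul_eq_mul]
  rw [hess_flat smallField_flat_zero, hess_flat smallField_flat_zero, neg_sub_neg, ← Finset.sum_sub_distrib]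
  refine Finset.sum_congr rfl fun p _ => ?_
  unfold T4AveragingDeficitWall.curl
  rw [curlAt_flat_weight g Y, curlAt_flat_weight g X, add_mul, mul_add, smul_mul_assoc, mul_smul_comm,
    T4TiltOscillation.nReTr_add, T4TiltOscillation.nReTr_add, hsm]
  ring

/-! ## §3 The by-parts letter, localised -/

/-- **THE BY-PARTS LETTER AT THE FLAT BACKGROUND, LOCALISED** (`NE7ExpansionSegmentLetters.abs_sum_nReTr_curlAt_flat_mul_le` with a set): for `P ≥ 1`, a
`P`-periodic direction `Y`, a `P`-periodic plaquette field `G` and a set of sites `V` with `‖G(z;μ,ν) − G(z − e_τ;μ,ν)‖ ≤ γ` for `z ∈ V` and `= 0` for `z ∉ V`: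
`|Σ_{p∈perWin d P} Re tr[d_1Y(p)·G(p)]∕N| ≤ γ·#Plane·‖Y‖_{ℓ¹(periodBox P ∩ V)}`. [folklore] -/
theorem abs_sum_nReTr_curlAt_flat_mul_le_local {P : ℕ} (hP : 1 ≤ P) {Y : Site d → Fin d → Matrix n n ℂ} (hYP : IsPeriodicDir Y (P : ℤ))
    {G : Site d → Fin d → Fin d → Matrix n n ℂ} (hGP : ∀ (z : Site d) (κ μ ν : Fin d), G (z + (P : ℤ) • e κ) μ ν = G z μ ν)
    (V : Site d → Prop) [DecidablePred V] {γ : ℝ} (hγ : 0 ≤ γ)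
    (hG : ∀ (z : Site d) (μ ν τ : Fin d), ‖G z μ ν - G (z - e τ) μ ν‖ ≤ if V z then γ else 0) :
    |∑ p ∈ perWin d P, nReTr (curlAt (flat (d := d) (n := n)) Y p.1 p.2.1.1 p.2.1.2 * G p.1 p.2.1.1 p.2.1.2)|
      ≤ γ * (Fintype.card (T4AveragingDeficitWall.Plane d) : ℝ) * dirL1 Y ((periodBox (d := d) P).filter V) := by
  unfold perWin T4AveragingDeficitWall.dirL1
  rw [Finset.sum_product, Finset.sum_comm, Finset.sum_filter]
  have hf0 : ∀ i, 0 ≤ ∑ z ∈ periodBox (d := d) P, (if V z then ‖Y z i‖ else 0) := fun i =>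
    Finset.sum_nonneg fun z _ => by split_ifs <;> first | exact norm_nonneg _ | exact le_rfl
  -- one plane
  have hplane : ∀ π : T4AveragingDeficitWall.Plane d,
      |∑ z ∈ periodBox (d := d) P, nReTr (curlAt (flat (d := d) (n := n)) Y z π.1.1 π.1.2 * G z π.1.1 π.1.2)|
        ≤ γ * (∑ z ∈ periodBox (d := d) P, (if V z then ‖Y z π.1.1‖ else 0) + ∑ z ∈ periodBox (d := d) P, (if V z then ‖Y z π.1.2‖ else 0)) := by
    intro π
    set μ := π.1.1
    set ν := π.1.2
    have hsplit : ∀ z : Site d, nReTr (curlAt (flat (d := d) (n := n)) Y z μ ν * G z μ ν)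
        = (nReTr (Y (z + e μ) ν * G z μ ν) - nReTr (Y z ν * G z μ ν)) - (nReTr (Y (z + e ν) μ * G z μ ν) - nReTr (Y z μ * G z μ ν)) := by
      intro z
      rw [curlAt_flat_eq, sub_mul, sub_mul, sub_mul, T4TiltOscillation.nReTr_sub, T4TiltOscillation.nReTr_sub,
        T4TiltOscillation.nReTr_sub]
    simp only [hsplit, Finset.sum_sub_distrib]
    have hs1 : ∑ z ∈ periodBox (d := d) P, nReTr (Y (z + e μ) ν * G z μ ν) = ∑ z ∈ periodBox (d := d) P, nReTr (Y z ν * G (z - e μ) μ ν) := by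
      have h := sum_periodBox_shift P hP (g := fun z => nReTr (Y z ν * G (z - e μ) μ ν)) (fun x κ => by
        show nReTr (Y (x + (P : ℤ) • e κ) ν * G (x + (P : ℤ) • e κ - e μ) μ ν) = nReTr (Y x ν * G (x - e μ) μ ν)
        rw [hYP x κ ν, add_sub_right_comm, hGP]) (e μ)
      simp only [add_sub_cancel_right] at h
      exact h
    have hs2 : ∑ z ∈ periodBox (d := d) P, nReTr (Y (z + e ν) μ * G z μ ν) = ∑ z ∈ periodBox (d := d) P, nReTr (Y z μ * G (z - e ν) μ ν) := by
      have h := sum_periodBox_shift P hP (g := fun z => nReTr (Y z μ * G (z - e ν) μ ν)) (fun x κ => by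
        show nReTr (Y (x + (P : ℤ) • e κ) μ * G (x + (P : ℤ) • e κ - e ν) μ ν) = nReTr (Y x μ * G (x - e ν) μ ν)
        rw [hYP x κ μ, add_sub_right_comm, hGP]) (e ν)
      simp only [add_sub_cancel_right] at h
      exact h
    rw [hs1, hs2, ← Finset.sum_sub_distrib, ← Finset.sum_sub_distrib, ← Finset.sum_sub_distrib]
    have hterm : ∀ z : Site d,
        (nReTr (Y z ν * G (z - e μ) μ ν) - nReTr (Y z ν * G z μ ν)) - (nReTr (Y z μ * G (z - e ν) μ ν) - nReTr (Y z μ * G z μ ν))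
          = nReTr (Y z ν * (G (z - e μ) μ ν - G z μ ν)) - nReTr (Y z μ * (G (z - e ν) μ ν - G z μ ν)) := by
      intro z
      rw [mul_sub, mul_sub, T4TiltOscillation.nReTr_sub, T4TiltOscillation.nReTr_sub]
    simp only [hterm]
    refine (Finset.abs_sum_le_sum_abs _ _).trans ?_
    have hbd : ∀ z ∈ periodBox (d := d) P,
        |nReTr (Y z ν * (G (z - e μ) μ ν - G z μ ν)) - nReTr (Y z μ * (G (z - e ν) μ ν - G z μ ν))|
          ≤ γ * (if V z then ‖Y z μ‖ else 0) + γ * (if V z then ‖Y z ν‖ else 0) := by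
      intro z _
      have h1 := abs_nReTr_mul_le (Y z ν) (G (z - e μ) μ ν - G z μ ν)
      have h2 := abs_nReTr_mul_le (Y z μ) (G (z - e ν) μ ν - G z μ ν)
      have g1 : ‖G (z - e μ) μ ν - G z μ ν‖ ≤ if V z then γ else 0 := by rw [norm_sub_rev]; exact hG z μ ν μ
      have g2 : ‖G (z - e ν) μ ν - G z μ ν‖ ≤ if V z then γ else 0 := by rw [norm_sub_rev]; exact hG z μ ν ν
      have e1 : ‖Y z ν‖ * ‖G (z - e μ) μ ν - G z μ ν‖ ≤ γ * (if V z then ‖Y z ν‖ else 0) := by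
        refine (mul_le_mul_of_nonneg_left g1 (norm_nonneg _)).trans (le_of_eq ?_)
        split_ifs <;> ring
      have e2 : ‖Y z μ‖ * ‖G (z - e ν) μ ν - G z μ ν‖ ≤ γ * (if V z then ‖Y z μ‖ else 0) := by
        refine (mul_le_mul_of_nonneg_left g2 (norm_nonneg _)).trans (le_of_eq ?_)
        split_ifs <;> ring
      have := abs_sub (nReTr (Y z ν * (G (z - e μ) μ ν - G z μ ν))) (nReTr (Y z μ * (G (z - e ν) μ ν - G z μ ν)))
      linarith
    refine (Finset.sum_le_sum hbd).trans (le_of_eq ?_)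
    rw [Finset.sum_add_distrib, ← Finset.mul_sum, ← Finset.mul_sum]
    ring
  -- sum over planes
  refine (Finset.abs_sum_le_sum_abs _ _).trans ?_
  have hsplitV : ∀ z : Site d, (if V z then ∑ κ : Fin d, ‖Y z κ‖ else 0) = ∑ κ : Fin d, (if V z then ‖Y z κ‖ else 0) := by
    intro z; split_ifs <;> simp
  simp only [hsplitV]
  calc ∑ π : T4AveragingDeficitWall.Plane d, |∑ z ∈ periodBox (d := d) P, nReTr (curlAt (flat (d := d) (n := n)) Y z π.1.1 π.1.2 * G z π.1.1 π.1.2)|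
      ≤ ∑ π : T4AveragingDeficitWall.Plane d,
          γ * (∑ z ∈ periodBox (d := d) P, (if V z then ‖Y z π.1.1‖ else 0) + ∑ z ∈ periodBox (d := d) P, (if V z then ‖Y z π.1.2‖ else 0)) :=
        Finset.sum_le_sum fun π _ => hplane π
    _ ≤ ∑ _π : T4AveragingDeficitWall.Plane d, γ * ∑ i, ∑ z ∈ periodBox (d := d) P, (if V z then ‖Y z i‖ else 0) :=
        Finset.sum_le_sum fun π _ =>
          mul_le_mul_of_nonneg_left (pair_le_sum (f := fun i => ∑ z ∈ periodBox (d := d) P, (if V z then ‖Y z i‖ else 0)) hf0 π) hγ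
    _ = γ * (Fintype.card (T4AveragingDeficitWall.Plane d) : ℝ) * ∑ z ∈ periodBox (d := d) P, ∑ κ, (if V z then ‖Y z κ‖ else 0) := by
        rw [Finset.sum_const, Finset.card_univ, nsmul_eq_mul, Finset.sum_comm]; ring

/-! ## §4 The commutator estimate -/

/-- **THE CUTOFF LEIBNIZ ESTIMATE FOR THE FLAT HESSIAN.**  `P ≥ 1`; `g : Site → ℝ` `P`-periodic with `|g(z+e_κ) − g(z)| ≤ c₁` and
`|(g(z+e_κ) − g(z)) − (g(z−e_τ+e_κ) − g(z−e_τ))| ≤ c₂` (all `z, κ, τ`); `X, Y` `P`-periodic directions, `‖X‖ ≤ α₀`, `‖X(y+e_τ,κ) − X(y,κ)‖ ≤ α₁`; `V′` a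
`P`-periodic set of sites such that whenever `g(z+e_κ) ≠ g(z)` the site `z` and all its forward neighbours `z + e_λ` lie in `V′`.  Then
`|hess_1(g•X,Y)(perWin d P) − hess_1(X,g•Y)(perWin d P)| ≤ 2·#Plane·(2c₁α₁ + c₂α₀)·‖Y‖_{ℓ¹(periodBox P ∩ V′)}`. [folklore] -/
theorem abs_hess_flat_weight_sub_le {P : ℕ} (hP : 1 ≤ P)
    (g : Site d → ℝ) (hgP : ∀ (y : Site d) (i : Fin d), g (y + (P : ℤ) • e i) = g y) {c₁ c₂ : ℝ} (hc₁ : 0 ≤ c₁) (hc₂ : 0 ≤ c₂)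
    (hg1 : ∀ (z : Site d) (κ : Fin d), |g (z + e κ) - g z| ≤ c₁)
    (hg2 : ∀ (z : Site d) (κ τ : Fin d), |(g (z + e κ) - g z) - (g (z - e τ + e κ) - g (z - e τ))| ≤ c₂)
    (V' : Site d → Prop) [DecidablePred V'] (hV'P : ∀ (z : Site d) (i : Fin d), V' (z + (P : ℤ) • e i) ↔ V' z)
    (hgV : ∀ (z : Site d) (κ : Fin d), g (z + e κ) ≠ g z → V' z ∧ ∀ lam : Fin d, V' (z + e lam))
    {X Y : Site d → Fin d → Matrix n n ℂ} (hXP : IsPeriodicDir X (P : ℤ)) (hYP : IsPeriodicDir Y (P : ℤ))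
    {α₀ α₁ : ℝ} (hα₀ : 0 ≤ α₀) (hα₁ : 0 ≤ α₁) (hXα : ∀ (y : Site d) (κ : Fin d), ‖X y κ‖ ≤ α₀)
    (hX1 : ∀ (y : Site d) (κ τ : Fin d), ‖X (y + e τ) κ - X y κ‖ ≤ α₁) :
    |hess (flat (d := d) (n := n)) (fun y κ => g y • X y κ) Y (perWin d P) - hess (flat (d := d) (n := n)) X (fun y κ => g y • Y y κ) (perWin d P)|
      ≤ 2 * (Fintype.card (T4AveragingDeficitWall.Plane d) : ℝ) * (2 * c₁ * α₁ + c₂ * α₀) * dirL1 Y ((periodBox (d := d) P).filter V') := by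
  classical
  rw [hess_flat_weight_sub, Finset.sum_sub_distrib]
  -- the commutator plaquette field of `X`, named
  obtain ⟨G, hGdef⟩ : ∃ G : Site d → Fin d → Fin d → Matrix n n ℂ,
      ∀ (z : Site d) (μ ν : Fin d), G z μ ν = (g (z + e μ) - g z) • X (z + e μ) ν - (g (z + e ν) - g z) • X (z + e ν) μ :=
    ⟨_, fun _ _ _ => rfl⟩
  simp only [← hGdef]
  -- `g` constant along every bond out of `z` ⇒ the commutator vanishes at `z`
  have hGzero : ∀ z : Site d, (∀ κ : Fin d, g (z + e κ) = g z) → ∀ μ ν : Fin d, G z μ ν = 0 := by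
    intro z hz μ ν
    rw [hGdef]
    simp only [hz, sub_self, zero_smul]
  have hconst : ∀ z : Site d, ¬ V' z → ∀ κ : Fin d, g (z + e κ) = g z := by
    intro z hz κ
    by_contra h
    exact hz (hgV z κ h).1
  have hconst' : ∀ (z : Site d) (τ : Fin d), ¬ V' z → ∀ κ : Fin d, g (z - e τ + e κ) = g (z - e τ) := by
    intro z τ hz κ
    by_contra h
    have h' := (hgV (z - e τ) κ h).2 τ
    rw [sub_add_cancel] at h'
    exact hz h'
  have hGP : ∀ (z : Site d) (κ μ ν : Fin d), G (z + (P : ℤ) • e κ) μ ν = G z μ ν := by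
    intro z κ μ ν
    have h1 : ∀ y : Site d, g (y + (P : ℤ) • e κ) = g y := fun y => hgP y κ
    have h2 : ∀ (y : Site d) (μ' : Fin d), X (y + (P : ℤ) • e κ) μ' = X y μ' := fun y μ' => hXP y κ μ'
    rw [hGdef, hGdef]
    simp only [add_right_comm z ((P : ℤ) • e κ), h1, h2]
  -- adjacent differences of `G`: one lattice difference of `X` against `c₁`, or `X` against a second difference of `g`
  have hGdiff : ∀ (z : Site d) (μ ν τ : Fin d), ‖G z μ ν - G (z - e τ) μ ν‖ ≤ if V' z then 2 * (c₁ * α₁ + c₂ * α₀) else 0 := by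
    intro z μ ν τ
    split_ifs with hz
    · have key : ∀ μ' ν' : Fin d, ‖(g (z + e μ') - g z) • X (z + e μ') ν' - (g (z - e τ + e μ') - g (z - e τ)) • X (z - e τ + e μ') ν'‖
          ≤ c₁ * α₁ + c₂ * α₀ := by
        intro μ' ν'
        have e1 : (g (z + e μ') - g z) • X (z + e μ') ν' - (g (z - e τ + e μ') - g (z - e τ)) • X (z - e τ + e μ') ν'
            = (g (z + e μ') - g z) • (X (z + e μ') ν' - X (z - e τ + e μ') ν')
              + ((g (z + e μ') - g z) - (g (z - e τ + e μ') - g (z - e τ))) • X (z - e τ + e μ') ν' := by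
          simp only [smul_sub, sub_smul]; abel
        rw [e1]
        refine (norm_add_le _ _).trans (add_le_add ?_ ?_)
        · rw [norm_smul, Real.norm_eq_abs]
          have hx : ‖X (z + e μ') ν' - X (z - e τ + e μ') ν'‖ ≤ α₁ := by
            have h := hX1 (z - e τ + e μ') ν' τ
            rwa [show z - e τ + e μ' + e τ = z + e μ' by abel] at h
          exact mul_le_mul (hg1 z μ') hx (norm_nonneg _) hc₁
        · rw [norm_smul, Real.norm_eq_abs]
          exact mul_le_mul (hg2 z μ' τ) (hXα _ _) (norm_nonneg _) hc₂
      rw [hGdef, hGdef, show ∀ a b c d' : Matrix n n ℂ, (a - b) - (c - d') = (a - c) - (b - d') from fun a b c d' => by abel]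
      calc ‖((g (z + e μ) - g z) • X (z + e μ) ν - (g (z - e τ + e μ) - g (z - e τ)) • X (z - e τ + e μ) ν)
            - ((g (z + e ν) - g z) • X (z + e ν) μ - (g (z - e τ + e ν) - g (z - e τ)) • X (z - e τ + e ν) μ)‖
          ≤ ‖(g (z + e μ) - g z) • X (z + e μ) ν - (g (z - e τ + e μ) - g (z - e τ)) • X (z - e τ + e μ) ν‖
            + ‖(g (z + e ν) - g z) • X (z + e ν) μ - (g (z - e τ + e ν) - g (z - e τ)) • X (z - e τ + e ν) μ‖ := norm_sub_le _ _
        _ ≤ (c₁ * α₁ + c₂ * α₀) + (c₁ * α₁ + c₂ * α₀) := add_le_add (key μ ν) (key ν μ)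
        _ = 2 * (c₁ * α₁ + c₂ * α₀) := by ring
    · rw [hGzero z (hconst z hz), hGzero (z - e τ) (hconst' z τ hz), sub_self, norm_zero]
  -- the filtered `ℓ¹` norm as a weighted sum
  have hnn : ∀ (z : Site d) (κ : Fin d), 0 ≤ (if V' z then ‖Y z κ‖ else 0) := fun z κ => by
    split_ifs <;> first | exact norm_nonneg _ | exact le_rfl
  have hdir : dirL1 Y ((periodBox (d := d) P).filter V') = ∑ z ∈ periodBox (d := d) P, ∑ κ : Fin d, (if V' z then ‖Y z κ‖ else 0) := by
    unfold T4AveragingDeficitWall.dirL1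
    rw [Finset.sum_filter]
    refine Finset.sum_congr rfl fun z _ => ?_
    split_ifs <;> simp
  -- T₁: the by-parts term
  have hT1 := abs_sum_nReTr_curlAt_flat_mul_le_local (n := n) hP hYP hGP V' (by positivity : (0 : ℝ) ≤ 2 * (c₁ * α₁ + c₂ * α₀)) hGdiff
  -- T₂: the direct term, `‖E^Y_p‖·‖d_1X(p)‖`
  have hpt : ∀ (z : Site d) (μ ν : Fin d), ‖(g (z + e μ) - g z) • Y (z + e μ) ν‖ ≤ c₁ * (if V' (z + e μ) then ‖Y (z + e μ) ν‖ else 0) := by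
    intro z μ ν
    by_cases h : g (z + e μ) = g z
    · rw [h, sub_self, zero_smul, norm_zero]
      exact mul_nonneg hc₁ (hnn _ _)
    · rw [if_pos ((hgV z μ h).2 μ), norm_smul, Real.norm_eq_abs]
      exact mul_le_mul_of_nonneg_right (hg1 z μ) (norm_nonneg _)
  have hshift : ∀ μ ν : Fin d, ∑ z ∈ periodBox (d := d) P, (if V' (z + e μ) then ‖Y (z + e μ) ν‖ else 0)
      = ∑ z ∈ periodBox (d := d) P, (if V' z then ‖Y z ν‖ else 0) := fun μ ν =>
    sum_periodBox_shift P hP (g := fun z => if V' z then ‖Y z ν‖ else 0) (fun x κ => by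
      show (if V' (x + (P : ℤ) • e κ) then ‖Y (x + (P : ℤ) • e κ) ν‖ else 0) = (if V' x then ‖Y x ν‖ else 0)
      rw [hYP x κ ν]
      exact if_congr (hV'P x κ) rfl rfl) (e μ)
  have hT2 : |∑ p ∈ perWin d P, nReTr (((g (p.1 + e p.2.1.1) - g p.1) • Y (p.1 + e p.2.1.1) p.2.1.2
        - (g (p.1 + e p.2.1.2) - g p.1) • Y (p.1 + e p.2.1.2) p.2.1.1) * curlAt (flat (d := d) (n := n)) X p.1 p.2.1.1 p.2.1.2)|
      ≤ 2 * α₁ * c₁ * (Fintype.card (T4AveragingDeficitWall.Plane d) : ℝ)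
          * ∑ z ∈ periodBox (d := d) P, ∑ κ : Fin d, (if V' z then ‖Y z κ‖ else 0) := by
    unfold perWin
    rw [Finset.sum_product, Finset.sum_comm]
    refine (Finset.abs_sum_le_sum_abs _ _).trans ?_
    have hf0 : ∀ i, 0 ≤ ∑ z ∈ periodBox (d := d) P, (if V' z then ‖Y z i‖ else 0) := fun i => Finset.sum_nonneg fun z _ => hnn z i
    have hplane : ∀ π : T4AveragingDeficitWall.Plane d,
        |∑ z ∈ periodBox (d := d) P, nReTr (((g (z + e π.1.1) - g z) • Y (z + e π.1.1) π.1.2 - (g (z + e π.1.2) - g z) • Y (z + e π.1.2) π.1.1)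
            * curlAt (flat (d := d) (n := n)) X z π.1.1 π.1.2)|
          ≤ 2 * α₁ * c₁ * (∑ z ∈ periodBox (d := d) P, (if V' z then ‖Y z π.1.1‖ else 0)
              + ∑ z ∈ periodBox (d := d) P, (if V' z then ‖Y z π.1.2‖ else 0)) := by
      intro π
      set μ := π.1.1
      set ν := π.1.2
      refine (Finset.abs_sum_le_sum_abs _ _).trans ?_
      have hbd : ∀ z ∈ periodBox (d := d) P,
          |nReTr (((g (z + e μ) - g z) • Y (z + e μ) ν - (g (z + e ν) - g z) • Y (z + e ν) μ) * curlAt (flat (d := d) (n := n)) X z μ ν)|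
            ≤ 2 * α₁ * c₁ * (if V' (z + e ν) then ‖Y (z + e ν) μ‖ else 0) + 2 * α₁ * c₁ * (if V' (z + e μ) then ‖Y (z + e μ) ν‖ else 0) := by
        intro z _
        refine (abs_nReTr_mul_le _ _).trans ?_
        have hc : ‖curlAt (flat (d := d) (n := n)) X z μ ν‖ ≤ 2 * α₁ := norm_curlAt_flat_le hX1 z μ ν
        have hE : ‖(g (z + e μ) - g z) • Y (z + e μ) ν - (g (z + e ν) - g z) • Y (z + e ν) μ‖
            ≤ c₁ * (if V' (z + e μ) then ‖Y (z + e μ) ν‖ else 0) + c₁ * (if V' (z + e ν) then ‖Y (z + e ν) μ‖ else 0) :=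
          (norm_sub_le _ _).trans (add_le_add (hpt z μ ν) (hpt z ν μ))
        have h0 : 0 ≤ c₁ * (if V' (z + e μ) then ‖Y (z + e μ) ν‖ else 0) + c₁ * (if V' (z + e ν) then ‖Y (z + e ν) μ‖ else 0) :=
          add_nonneg (mul_nonneg hc₁ (hnn _ _)) (mul_nonneg hc₁ (hnn _ _))
        calc ‖(g (z + e μ) - g z) • Y (z + e μ) ν - (g (z + e ν) - g z) • Y (z + e ν) μ‖ * ‖curlAt (flat (d := d) (n := n)) X z μ ν‖
            ≤ (c₁ * (if V' (z + e μ) then ‖Y (z + e μ) ν‖ else 0) + c₁ * (if V' (z + e ν) then ‖Y (z + e ν) μ‖ else 0)) * (2 * α₁) :=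
              mul_le_mul hE hc (norm_nonneg _) h0
          _ = _ := by ring
      refine (Finset.sum_le_sum hbd).trans (le_of_eq ?_)
      rw [Finset.sum_add_distrib, ← Finset.mul_sum, ← Finset.mul_sum, hshift ν μ, hshift μ ν]
      ring
    calc ∑ π : T4AveragingDeficitWall.Plane d,
          |∑ z ∈ periodBox (d := d) P, nReTr (((g (z + e π.1.1) - g z) • Y (z + e π.1.1) π.1.2 - (g (z + e π.1.2) - g z) • Y (z + e π.1.2) π.1.1)
            * curlAt (flat (d := d) (n := n)) X z π.1.1 π.1.2)|
        ≤ ∑ π : T4AveragingDeficitWall.Plane d, 2 * α₁ * c₁ * (∑ z ∈ periodBox (d := d) P, (if V' z then ‖Y z π.1.1‖ else 0)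
              + ∑ z ∈ periodBox (d := d) P, (if V' z then ‖Y z π.1.2‖ else 0)) := Finset.sum_le_sum fun π _ => hplane π
      _ ≤ ∑ _π : T4AveragingDeficitWall.Plane d, 2 * α₁ * c₁ * ∑ i, ∑ z ∈ periodBox (d := d) P, (if V' z then ‖Y z i‖ else 0) :=
          Finset.sum_le_sum fun π _ =>
            mul_le_mul_of_nonneg_left (pair_le_sum (f := fun i => ∑ z ∈ periodBox (d := d) P, (if V' z then ‖Y z i‖ else 0)) hf0 π)
              (by positivity)
      _ = 2 * α₁ * c₁ * (Fintype.card (T4AveragingDeficitWall.Plane d) : ℝ)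
            * ∑ z ∈ periodBox (d := d) P, ∑ κ : Fin d, (if V' z then ‖Y z κ‖ else 0) := by
          rw [Finset.sum_const, Finset.card_univ, nsmul_eq_mul, Finset.sum_comm]; ring
  rw [← hdir] at hT2
  have hsum0 : 0 ≤ dirL1 Y ((periodBox (d := d) P).filter V') := Finset.sum_nonneg fun _ _ => Finset.sum_nonneg fun _ _ => norm_nonneg _
  refine (abs_sub _ _).trans ?_
  have htot : 2 * α₁ * c₁ * (Fintype.card (T4AveragingDeficitWall.Plane d) : ℝ) * dirL1 Y ((periodBox (d := d) P).filter V')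
      + 2 * (c₁ * α₁ + c₂ * α₀) * (Fintype.card (T4AveragingDeficitWall.Plane d) : ℝ) * dirL1 Y ((periodBox (d := d) P).filter V')
      = 2 * (Fintype.card (T4AveragingDeficitWall.Plane d) : ℝ) * (2 * c₁ * α₁ + c₂ * α₀) * dirL1 Y ((periodBox (d := d) P).filter V') := by
    ring
  linarith

end

end Summit.QuantumFields.BalabanUV.T4Continuum.NE7HessFlatCutoffLeibniz
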